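import Mathlib
import Summits.Ventures.PercRepro2.Tail2DBlockCalc
import Summits.Ventures.PercRepro2.Tail2DHarrisSP
import Summits.Ventures.PercRepro2.Tail2DFlowOneBlocks
import Summits.Ventures.PercRepro2.Tail2DFlowOnePar
import Summits.Ventures.PercRepro2.Tail2DSDomSwap
import Summits.Ventures.PercRepro2.Tail2DFlowOneStep01
import Summits.Ventures.PercRepro2.Tail2DFlowOneThreeCounts
import Summits.Ventures.PercRepro2.Tail2DParFin
import Summits.Ventures.PercRepro2.Tail2DFlowOneAxis
import Summits.Ventures.PercRepro2.Tail2DAxisClass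
import Summits.Ventures.PercRepro2.Tail2DFourIdent
import Summits.Ventures.PercRepro2.Tail2DRelayBlocks
import Summits.Ventures.PercRepro2.Tail2DRelay20Comb
import Summits.Ventures.PercRepro2.Tail2DRelayU0Weights
import Summits.Ventures.PercRepro2.Tail2DRelayU0Blocks
import Summits.Ventures.PercRepro2.Tail2DRelayU0
import Summits.Ventures.PercRepro2.Tail2DParRecursion
import Summits.Ventures.PercRepro2.Tail2DFiveGen

/-!
# (SD) at `(4,0)` on six flow-one factors with arbitrary sizes, the two least C-heavy factors in front
(seat mine-b, cell pub-perc-repro2; conjectures/MINE-B.md §45.13)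

The relay at `(4,0)` on `X₀ ∥ (X₁ ∥ … ∥ X₅)` (`sdomZ_par_relay_u0` at `m = 2`) with `(3,0)` of the sub-comb from
`sdomZ_five_30_front` (so the sub-comb's front factor `X₁` must be its least C-heavy one), the sub-top `(4,0)` and the
red axis; the three count inequalities after the substitution `c_i = a_i (g + d_i)`, `g = c₀/a₀`, are polynomials
with non-negative coefficients (§45.11) — `ring_nf` + `positivity`.
-/

namespace Summit.Ventures.PercRepro2.Tail2D

open V2Closure Finset


section Six


set_option maxHeartbeats 400000 in
/-- inequality (I) of the relay at `(4,0)` on six factors -/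
theorem six40_I (X : Fin 6 → V2Closure.SP) (hX : ∀ i, FlowOne (X i)) (hR : ∀ i, 0 < (rSet (X i)).card)
    (hmin : FrontMinGamma X) :
    tailCount (parFin 5 (Fin.tail X)) (2 + 2) 0 * (tailCount (parFin 5 (Fin.tail X)) (2 + 1) 0 + tailCount (parFin 5 (Fin.tail X)) 2 1)
      ≤ tailCount (parFin 5 (Fin.tail X)) (2 + 1) 1 * (tailCount (parFin 5 (Fin.tail X)) (2 + 2) 0 + tailCount (parFin 5 (Fin.tail X)) (2 + 1) 0) := by
  -- the rational substitution `c_i = a_i (g + d_i)`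
  have ha : ∀ i, (0 : ℚ) < (rSet (X i)).card := fun i => by exact_mod_cast hR i
  have ha' : ∀ i, ((rSet (X i)).card : ℚ) ≠ 0 := fun i => ne_of_gt (ha i)
  obtain ⟨g, hg⟩ : ∃ g : ℚ, g = ((cellSet (X 0)).card : ℚ) / (rSet (X 0)).card := ⟨_, rfl⟩
  have hg0 : 0 ≤ g := by rw [hg]; exact div_nonneg (Nat.cast_nonneg _) (Nat.cast_nonneg _)
  have hc0 : ((cellSet (X 0)).card : ℚ) = (rSet (X 0)).card * g := by
    rw [hg, mul_div_assoc', mul_comm, mul_div_assoc, div_self (ha' 0), mul_one]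
  have hd : ∀ i, 0 ≤ ((cellSet (X i)).card : ℚ) / (rSet (X i)).card - g := by
    intro i
    rw [hg, sub_nonneg, div_le_div_iff₀ (ha 0) (ha i)]
    exact_mod_cast hmin i
  have hc : ∀ i, ((cellSet (X i)).card : ℚ)
      = (rSet (X i)).card * (g + (((cellSet (X i)).card : ℚ) / (rSet (X i)).card - g)) := by
    intro i
    rw [add_sub_cancel, mul_div_assoc', mul_comm, mul_div_assoc, div_self (ha' i), mul_one]
  obtain ⟨d1, hd1⟩ : ∃ d : ℚ, d = ((cellSet (X 1)).card : ℚ) / (rSet (X 1)).card - g := ⟨_, rfl⟩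
  obtain ⟨d2, hd2⟩ : ∃ d : ℚ, d = ((cellSet (X 2)).card : ℚ) / (rSet (X 2)).card - g := ⟨_, rfl⟩
  obtain ⟨d3, hd3⟩ : ∃ d : ℚ, d = ((cellSet (X 3)).card : ℚ) / (rSet (X 3)).card - g := ⟨_, rfl⟩
  obtain ⟨d4, hd4⟩ : ∃ d : ℚ, d = ((cellSet (X 4)).card : ℚ) / (rSet (X 4)).card - g := ⟨_, rfl⟩
  obtain ⟨d5, hd5⟩ : ∃ d : ℚ, d = ((cellSet (X 5)).card : ℚ) / (rSet (X 5)).card - g := ⟨_, rfl⟩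
  have hd1' : 0 ≤ d1 := by rw [hd1]; exact hd 1
  have hd2' : 0 ≤ d2 := by rw [hd2]; exact hd 2
  have hd3' : 0 ≤ d3 := by rw [hd3]; exact hd 3
  have hd4' : 0 ≤ d4 := by rw [hd4]; exact hd 4
  have hd5' : 0 ≤ d5 := by rw [hd5]; exact hd 5
  have hc1 : ((cellSet (X 1)).card : ℚ) = (rSet (X 1)).card * (g + d1) := by rw [hd1]; exact hc 1
  have hc2 : ((cellSet (X 2)).card : ℚ) = (rSet (X 2)).card * (g + d2) := by rw [hd2]; exact hc 2
  have hc3 : ((cellSet (X 3)).card : ℚ) = (rSet (X 3)).card * (g + d3) := by rw [hd3]; exact hc 3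
  have hc4 : ((cellSet (X 4)).card : ℚ) = (rSet (X 4)).card * (g + d4) := by rw [hd4]; exact hc 4
  have hc5 : ((cellSet (X 5)).card : ℚ) = (rSet (X 5)).card * (g + d5) := by rw [hd5]; exact hc 5
  obtain ⟨a0, ea0⟩ : ∃ a : ℚ, a = ((rSet (X 0)).card : ℚ) := ⟨_, rfl⟩
  obtain ⟨a1, ea1⟩ : ∃ a : ℚ, a = ((rSet (X 1)).card : ℚ) := ⟨_, rfl⟩
  obtain ⟨a2, ea2⟩ : ∃ a : ℚ, a = ((rSet (X 2)).card : ℚ) := ⟨_, rfl⟩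
  obtain ⟨a3, ea3⟩ : ∃ a : ℚ, a = ((rSet (X 3)).card : ℚ) := ⟨_, rfl⟩
  obtain ⟨a4, ea4⟩ : ∃ a : ℚ, a = ((rSet (X 4)).card : ℚ) := ⟨_, rfl⟩
  obtain ⟨a5, ea5⟩ : ∃ a : ℚ, a = ((rSet (X 5)).card : ℚ) := ⟨_, rfl⟩
  have ha0 : 0 < a0 := by rw [ea0]; exact ha 0
  have ha1 : 0 < a1 := by rw [ea1]; exact ha 1
  have ha2 : 0 < a2 := by rw [ea2]; exact ha 2
  have ha3 : 0 < a3 := by rw [ea3]; exact ha 3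
  have ha4 : 0 < a4 := by rw [ea4]; exact ha 4
  have ha5 : 0 < a5 := by rw [ea5]; exact ha 5
  obtain ⟨c0, ec0⟩ : ∃ c : ℚ, c = ((cellSet (X 0)).card : ℚ) := ⟨_, rfl⟩
  obtain ⟨c1, ec1⟩ : ∃ c : ℚ, c = ((cellSet (X 1)).card : ℚ) := ⟨_, rfl⟩
  obtain ⟨c2, ec2⟩ : ∃ c : ℚ, c = ((cellSet (X 2)).card : ℚ) := ⟨_, rfl⟩
  obtain ⟨c3, ec3⟩ : ∃ c : ℚ, c = ((cellSet (X 3)).card : ℚ) := ⟨_, rfl⟩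
  obtain ⟨c4, ec4⟩ : ∃ c : ℚ, c = ((cellSet (X 4)).card : ℚ) := ⟨_, rfl⟩
  obtain ⟨c5, ec5⟩ : ∃ c : ℚ, c = ((cellSet (X 5)).card : ℚ) := ⟨_, rfl⟩
  have hc0' : 0 ≤ c0 := by rw [ec0]; exact Nat.cast_nonneg _
  have hc1' : 0 ≤ c1 := by rw [ec1]; exact Nat.cast_nonneg _
  have hc2' : 0 ≤ c2 := by rw [ec2]; exact Nat.cast_nonneg _
  have hc3' : 0 ≤ c3 := by rw [ec3]; exact Nat.cast_nonneg _
  have hc4' : 0 ≤ c4 := by rw [ec4]; exact Nat.cast_nonneg _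
  have hc5' : 0 ≤ c5 := by rw [ec5]; exact Nat.cast_nonneg _
  rw [← ea1, ← ec1] at hc1; rw [← ea2, ← ec2] at hc2; rw [← ea3, ← ec3] at hc3; rw [← ea4, ← ec4] at hc4
  rw [← ea5, ← ec5] at hc5
  rw [← ea0, ← ec0] at hc0
  have eY : parFin 5 (Fin.tail X)
      = V2Closure.SP.par (X 1) (V2Closure.SP.par (X 2) (V2Closure.SP.par (X 3) (V2Closure.SP.par (X 4)
          (V2Closure.SP.par (X 5) V2Closure.SP.absent)))) := rfl
  have h : (tailCount (parFin 5 (Fin.tail X)) (2 + 2) 0 : ℚ) * (tailCount (parFin 5 (Fin.tail X)) (2 + 1) 0 + tailCount (parFin 5 (Fin.tail X)) 2 1)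
      ≤ tailCount (parFin 5 (Fin.tail X)) (2 + 1) 1 * (tailCount (parFin 5 (Fin.tail X)) (2 + 2) 0 + tailCount (parFin 5 (Fin.tail X)) (2 + 1) 0) := by
    rw [eY]
    simp only [tailCount_par_succ_succ _ _ (hX _), tailCount_par_succ_zero _ _ (hX _),
      tailCount_par_zero_succ _ _ (hX _), tailCount_par_zero_zero _ _ (hX _), tailCount_absent_eq]
    norm_num
    rw [← ea1, ← ea2, ← ea3, ← ea4, ← ea5, ← ec1, ← ec2, ← ec3, ← ec4, ← ec5, hc1, hc2, hc3, hc4, hc5, ← sub_nonneg]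
    ring_nf
    positivity
  exact_mod_cast h

set_option maxHeartbeats 800000 in
/-- inequality (II) of the relay at `(4,0)` on six factors -/
theorem six40_II (X : Fin 6 → V2Closure.SP) (hX : ∀ i, FlowOne (X i)) (hR : ∀ i, 0 < (rSet (X i)).card)
    (hmin : FrontMinGamma X) :
    (cellSet (X 0)).card * tailCount (parFin 5 (Fin.tail X)) (2 + 1) 0 * tailCount (parFin 5 (Fin.tail X)) (2 + 1) 1
      ≤ ((rSet (X 0)).card + (cellSet (X 0)).card) * tailCount (parFin 5 (Fin.tail X)) (2 + 2) 0
        * (tailCount (parFin 5 (Fin.tail X)) 2 1 + tailCount (parFin 5 (Fin.tail X)) (2 + 1) 0) := by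
  -- the rational substitution `c_i = a_i (g + d_i)`
  have ha : ∀ i, (0 : ℚ) < (rSet (X i)).card := fun i => by exact_mod_cast hR i
  have ha' : ∀ i, ((rSet (X i)).card : ℚ) ≠ 0 := fun i => ne_of_gt (ha i)
  obtain ⟨g, hg⟩ : ∃ g : ℚ, g = ((cellSet (X 0)).card : ℚ) / (rSet (X 0)).card := ⟨_, rfl⟩
  have hg0 : 0 ≤ g := by rw [hg]; exact div_nonneg (Nat.cast_nonneg _) (Nat.cast_nonneg _)
  have hc0 : ((cellSet (X 0)).card : ℚ) = (rSet (X 0)).card * g := by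
    rw [hg, mul_div_assoc', mul_comm, mul_div_assoc, div_self (ha' 0), mul_one]
  have hd : ∀ i, 0 ≤ ((cellSet (X i)).card : ℚ) / (rSet (X i)).card - g := by
    intro i
    rw [hg, sub_nonneg, div_le_div_iff₀ (ha 0) (ha i)]
    exact_mod_cast hmin i
  have hc : ∀ i, ((cellSet (X i)).card : ℚ)
      = (rSet (X i)).card * (g + (((cellSet (X i)).card : ℚ) / (rSet (X i)).card - g)) := by
    intro i
    rw [add_sub_cancel, mul_div_assoc', mul_comm, mul_div_assoc, div_self (ha' i), mul_one]
  obtain ⟨d1, hd1⟩ : ∃ d : ℚ, d = ((cellSet (X 1)).card : ℚ) / (rSet (X 1)).card - g := ⟨_, rfl⟩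
  obtain ⟨d2, hd2⟩ : ∃ d : ℚ, d = ((cellSet (X 2)).card : ℚ) / (rSet (X 2)).card - g := ⟨_, rfl⟩
  obtain ⟨d3, hd3⟩ : ∃ d : ℚ, d = ((cellSet (X 3)).card : ℚ) / (rSet (X 3)).card - g := ⟨_, rfl⟩
  obtain ⟨d4, hd4⟩ : ∃ d : ℚ, d = ((cellSet (X 4)).card : ℚ) / (rSet (X 4)).card - g := ⟨_, rfl⟩
  obtain ⟨d5, hd5⟩ : ∃ d : ℚ, d = ((cellSet (X 5)).card : ℚ) / (rSet (X 5)).card - g := ⟨_, rfl⟩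
  have hd1' : 0 ≤ d1 := by rw [hd1]; exact hd 1
  have hd2' : 0 ≤ d2 := by rw [hd2]; exact hd 2
  have hd3' : 0 ≤ d3 := by rw [hd3]; exact hd 3
  have hd4' : 0 ≤ d4 := by rw [hd4]; exact hd 4
  have hd5' : 0 ≤ d5 := by rw [hd5]; exact hd 5
  have hc1 : ((cellSet (X 1)).card : ℚ) = (rSet (X 1)).card * (g + d1) := by rw [hd1]; exact hc 1
  have hc2 : ((cellSet (X 2)).card : ℚ) = (rSet (X 2)).card * (g + d2) := by rw [hd2]; exact hc 2
  have hc3 : ((cellSet (X 3)).card : ℚ) = (rSet (X 3)).card * (g + d3) := by rw [hd3]; exact hc 3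
  have hc4 : ((cellSet (X 4)).card : ℚ) = (rSet (X 4)).card * (g + d4) := by rw [hd4]; exact hc 4
  have hc5 : ((cellSet (X 5)).card : ℚ) = (rSet (X 5)).card * (g + d5) := by rw [hd5]; exact hc 5
  obtain ⟨a0, ea0⟩ : ∃ a : ℚ, a = ((rSet (X 0)).card : ℚ) := ⟨_, rfl⟩
  obtain ⟨a1, ea1⟩ : ∃ a : ℚ, a = ((rSet (X 1)).card : ℚ) := ⟨_, rfl⟩
  obtain ⟨a2, ea2⟩ : ∃ a : ℚ, a = ((rSet (X 2)).card : ℚ) := ⟨_, rfl⟩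
  obtain ⟨a3, ea3⟩ : ∃ a : ℚ, a = ((rSet (X 3)).card : ℚ) := ⟨_, rfl⟩
  obtain ⟨a4, ea4⟩ : ∃ a : ℚ, a = ((rSet (X 4)).card : ℚ) := ⟨_, rfl⟩
  obtain ⟨a5, ea5⟩ : ∃ a : ℚ, a = ((rSet (X 5)).card : ℚ) := ⟨_, rfl⟩
  have ha0 : 0 < a0 := by rw [ea0]; exact ha 0
  have ha1 : 0 < a1 := by rw [ea1]; exact ha 1
  have ha2 : 0 < a2 := by rw [ea2]; exact ha 2
  have ha3 : 0 < a3 := by rw [ea3]; exact ha 3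
  have ha4 : 0 < a4 := by rw [ea4]; exact ha 4
  have ha5 : 0 < a5 := by rw [ea5]; exact ha 5
  obtain ⟨c0, ec0⟩ : ∃ c : ℚ, c = ((cellSet (X 0)).card : ℚ) := ⟨_, rfl⟩
  obtain ⟨c1, ec1⟩ : ∃ c : ℚ, c = ((cellSet (X 1)).card : ℚ) := ⟨_, rfl⟩
  obtain ⟨c2, ec2⟩ : ∃ c : ℚ, c = ((cellSet (X 2)).card : ℚ) := ⟨_, rfl⟩
  obtain ⟨c3, ec3⟩ : ∃ c : ℚ, c = ((cellSet (X 3)).card : ℚ) := ⟨_, rfl⟩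
  obtain ⟨c4, ec4⟩ : ∃ c : ℚ, c = ((cellSet (X 4)).card : ℚ) := ⟨_, rfl⟩
  obtain ⟨c5, ec5⟩ : ∃ c : ℚ, c = ((cellSet (X 5)).card : ℚ) := ⟨_, rfl⟩
  have hc0' : 0 ≤ c0 := by rw [ec0]; exact Nat.cast_nonneg _
  have hc1' : 0 ≤ c1 := by rw [ec1]; exact Nat.cast_nonneg _
  have hc2' : 0 ≤ c2 := by rw [ec2]; exact Nat.cast_nonneg _
  have hc3' : 0 ≤ c3 := by rw [ec3]; exact Nat.cast_nonneg _
  have hc4' : 0 ≤ c4 := by rw [ec4]; exact Nat.cast_nonneg _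
  have hc5' : 0 ≤ c5 := by rw [ec5]; exact Nat.cast_nonneg _
  rw [← ea1, ← ec1] at hc1; rw [← ea2, ← ec2] at hc2; rw [← ea3, ← ec3] at hc3; rw [← ea4, ← ec4] at hc4
  rw [← ea5, ← ec5] at hc5
  rw [← ea0, ← ec0] at hc0
  have eY : parFin 5 (Fin.tail X)
      = V2Closure.SP.par (X 1) (V2Closure.SP.par (X 2) (V2Closure.SP.par (X 3) (V2Closure.SP.par (X 4)
          (V2Closure.SP.par (X 5) V2Closure.SP.absent)))) := rfl
  have h : ((cellSet (X 0)).card : ℚ) * tailCount (parFin 5 (Fin.tail X)) (2 + 1) 0 * tailCount (parFin 5 (Fin.tail X)) (2 + 1) 1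
      ≤ ((rSet (X 0)).card + (cellSet (X 0)).card) * tailCount (parFin 5 (Fin.tail X)) (2 + 2) 0
        * (tailCount (parFin 5 (Fin.tail X)) 2 1 + tailCount (parFin 5 (Fin.tail X)) (2 + 1) 0) := by
    rw [eY]
    simp only [tailCount_par_succ_succ _ _ (hX _), tailCount_par_succ_zero _ _ (hX _),
      tailCount_par_zero_succ _ _ (hX _), tailCount_par_zero_zero _ _ (hX _), tailCount_absent_eq]
    norm_num
    rw [← ea0, ← ea1, ← ea2, ← ea3, ← ea4, ← ea5, ← ec0, ← ec1, ← ec2, ← ec3, ← ec4, ← ec5, hc0, hc1, hc2, hc3, hc4, hc5, ← sub_nonneg]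
    ring_nf
    positivity
  exact_mod_cast h

set_option maxHeartbeats 4000000 in
set_option maxRecDepth 10000 in
/-- inequality (III) of the relay at `(4,0)` on six factors (one large `ring_nf`) -/
theorem six40_III (X : Fin 6 → V2Closure.SP) (hX : ∀ i, FlowOne (X i)) (hR : ∀ i, 0 < (rSet (X i)).card)
    (hmin : FrontMinGamma X) :
    tailCount (parFin 5 (Fin.tail X)) (2 + 1) 1 * ((rSet (X 0)).card * tailCount (parFin 5 (Fin.tail X)) (2 + 1) 0
          + ((rSet (X 0)).card + (cellSet (X 0)).card) * tailCount (parFin 5 (Fin.tail X)) (2 + 2) 0)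
        * (((rSet (X 0)).card + (cellSet (X 0)).card) * tailCount (parFin 5 (Fin.tail X)) (2 + 1) 0
          + (rSet (X 0)).card * tailCount (parFin 5 (Fin.tail X)) 2 1)
      ≤ tailCount (parFin 5 (Fin.tail X)) (2 + 1) 0 * ((rSet (X 0)).card * tailCount (parFin 5 (Fin.tail X)) (2 + 1) 1
          + ((rSet (X 0)).card + (cellSet (X 0)).card) * tailCount (parFin 5 (Fin.tail X)) (2 + 2) 0)
        * ((rSet (X 0)).card * tailCount (parFin 5 (Fin.tail X)) 2 1 + (rSet (X 0)).card * tailCount (parFin 5 (Fin.tail X)) (2 + 1) 0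
          + (cellSet (X 0)).card * tailCount (parFin 5 (Fin.tail X)) (2 + 1) 1) := by
  -- the rational substitution `c_i = a_i (g + d_i)`
  have ha : ∀ i, (0 : ℚ) < (rSet (X i)).card := fun i => by exact_mod_cast hR i
  have ha' : ∀ i, ((rSet (X i)).card : ℚ) ≠ 0 := fun i => ne_of_gt (ha i)
  obtain ⟨g, hg⟩ : ∃ g : ℚ, g = ((cellSet (X 0)).card : ℚ) / (rSet (X 0)).card := ⟨_, rfl⟩
  have hg0 : 0 ≤ g := by rw [hg]; exact div_nonneg (Nat.cast_nonneg _) (Nat.cast_nonneg _)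
  have hc0 : ((cellSet (X 0)).card : ℚ) = (rSet (X 0)).card * g := by
    rw [hg, mul_div_assoc', mul_comm, mul_div_assoc, div_self (ha' 0), mul_one]
  have hd : ∀ i, 0 ≤ ((cellSet (X i)).card : ℚ) / (rSet (X i)).card - g := by
    intro i
    rw [hg, sub_nonneg, div_le_div_iff₀ (ha 0) (ha i)]
    exact_mod_cast hmin i
  have hc : ∀ i, ((cellSet (X i)).card : ℚ)
      = (rSet (X i)).card * (g + (((cellSet (X i)).card : ℚ) / (rSet (X i)).card - g)) := by
    intro i
    rw [add_sub_cancel, mul_div_assoc', mul_comm, mul_div_assoc, div_self (ha' i), mul_one]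
  obtain ⟨d1, hd1⟩ : ∃ d : ℚ, d = ((cellSet (X 1)).card : ℚ) / (rSet (X 1)).card - g := ⟨_, rfl⟩
  obtain ⟨d2, hd2⟩ : ∃ d : ℚ, d = ((cellSet (X 2)).card : ℚ) / (rSet (X 2)).card - g := ⟨_, rfl⟩
  obtain ⟨d3, hd3⟩ : ∃ d : ℚ, d = ((cellSet (X 3)).card : ℚ) / (rSet (X 3)).card - g := ⟨_, rfl⟩
  obtain ⟨d4, hd4⟩ : ∃ d : ℚ, d = ((cellSet (X 4)).card : ℚ) / (rSet (X 4)).card - g := ⟨_, rfl⟩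
  obtain ⟨d5, hd5⟩ : ∃ d : ℚ, d = ((cellSet (X 5)).card : ℚ) / (rSet (X 5)).card - g := ⟨_, rfl⟩
  have hd1' : 0 ≤ d1 := by rw [hd1]; exact hd 1
  have hd2' : 0 ≤ d2 := by rw [hd2]; exact hd 2
  have hd3' : 0 ≤ d3 := by rw [hd3]; exact hd 3
  have hd4' : 0 ≤ d4 := by rw [hd4]; exact hd 4
  have hd5' : 0 ≤ d5 := by rw [hd5]; exact hd 5
  have hc1 : ((cellSet (X 1)).card : ℚ) = (rSet (X 1)).card * (g + d1) := by rw [hd1]; exact hc 1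
  have hc2 : ((cellSet (X 2)).card : ℚ) = (rSet (X 2)).card * (g + d2) := by rw [hd2]; exact hc 2
  have hc3 : ((cellSet (X 3)).card : ℚ) = (rSet (X 3)).card * (g + d3) := by rw [hd3]; exact hc 3
  have hc4 : ((cellSet (X 4)).card : ℚ) = (rSet (X 4)).card * (g + d4) := by rw [hd4]; exact hc 4
  have hc5 : ((cellSet (X 5)).card : ℚ) = (rSet (X 5)).card * (g + d5) := by rw [hd5]; exact hc 5
  obtain ⟨a0, ea0⟩ : ∃ a : ℚ, a = ((rSet (X 0)).card : ℚ) := ⟨_, rfl⟩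
  obtain ⟨a1, ea1⟩ : ∃ a : ℚ, a = ((rSet (X 1)).card : ℚ) := ⟨_, rfl⟩
  obtain ⟨a2, ea2⟩ : ∃ a : ℚ, a = ((rSet (X 2)).card : ℚ) := ⟨_, rfl⟩
  obtain ⟨a3, ea3⟩ : ∃ a : ℚ, a = ((rSet (X 3)).card : ℚ) := ⟨_, rfl⟩
  obtain ⟨a4, ea4⟩ : ∃ a : ℚ, a = ((rSet (X 4)).card : ℚ) := ⟨_, rfl⟩
  obtain ⟨a5, ea5⟩ : ∃ a : ℚ, a = ((rSet (X 5)).card : ℚ) := ⟨_, rfl⟩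
  have ha0 : 0 < a0 := by rw [ea0]; exact ha 0
  have ha1 : 0 < a1 := by rw [ea1]; exact ha 1
  have ha2 : 0 < a2 := by rw [ea2]; exact ha 2
  have ha3 : 0 < a3 := by rw [ea3]; exact ha 3
  have ha4 : 0 < a4 := by rw [ea4]; exact ha 4
  have ha5 : 0 < a5 := by rw [ea5]; exact ha 5
  obtain ⟨c0, ec0⟩ : ∃ c : ℚ, c = ((cellSet (X 0)).card : ℚ) := ⟨_, rfl⟩
  obtain ⟨c1, ec1⟩ : ∃ c : ℚ, c = ((cellSet (X 1)).card : ℚ) := ⟨_, rfl⟩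
  obtain ⟨c2, ec2⟩ : ∃ c : ℚ, c = ((cellSet (X 2)).card : ℚ) := ⟨_, rfl⟩
  obtain ⟨c3, ec3⟩ : ∃ c : ℚ, c = ((cellSet (X 3)).card : ℚ) := ⟨_, rfl⟩
  obtain ⟨c4, ec4⟩ : ∃ c : ℚ, c = ((cellSet (X 4)).card : ℚ) := ⟨_, rfl⟩
  obtain ⟨c5, ec5⟩ : ∃ c : ℚ, c = ((cellSet (X 5)).card : ℚ) := ⟨_, rfl⟩
  have hc0' : 0 ≤ c0 := by rw [ec0]; exact Nat.cast_nonneg _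
  have hc1' : 0 ≤ c1 := by rw [ec1]; exact Nat.cast_nonneg _
  have hc2' : 0 ≤ c2 := by rw [ec2]; exact Nat.cast_nonneg _
  have hc3' : 0 ≤ c3 := by rw [ec3]; exact Nat.cast_nonneg _
  have hc4' : 0 ≤ c4 := by rw [ec4]; exact Nat.cast_nonneg _
  have hc5' : 0 ≤ c5 := by rw [ec5]; exact Nat.cast_nonneg _
  rw [← ea1, ← ec1] at hc1; rw [← ea2, ← ec2] at hc2; rw [← ea3, ← ec3] at hc3; rw [← ea4, ← ec4] at hc4
  rw [← ea5, ← ec5] at hc5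
  rw [← ea0, ← ec0] at hc0
  have eY : parFin 5 (Fin.tail X)
      = V2Closure.SP.par (X 1) (V2Closure.SP.par (X 2) (V2Closure.SP.par (X 3) (V2Closure.SP.par (X 4)
          (V2Closure.SP.par (X 5) V2Closure.SP.absent)))) := rfl
  have h : (tailCount (parFin 5 (Fin.tail X)) (2 + 1) 1 : ℚ) * ((rSet (X 0)).card * tailCount (parFin 5 (Fin.tail X)) (2 + 1) 0
        + ((rSet (X 0)).card + (cellSet (X 0)).card) * tailCount (parFin 5 (Fin.tail X)) (2 + 2) 0)
      * (((rSet (X 0)).card + (cellSet (X 0)).card) * tailCount (parFin 5 (Fin.tail X)) (2 + 1) 0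
        + (rSet (X 0)).card * tailCount (parFin 5 (Fin.tail X)) 2 1)
    ≤ tailCount (parFin 5 (Fin.tail X)) (2 + 1) 0 * ((rSet (X 0)).card * tailCount (parFin 5 (Fin.tail X)) (2 + 1) 1
        + ((rSet (X 0)).card + (cellSet (X 0)).card) * tailCount (parFin 5 (Fin.tail X)) (2 + 2) 0)
      * ((rSet (X 0)).card * tailCount (parFin 5 (Fin.tail X)) 2 1 + (rSet (X 0)).card * tailCount (parFin 5 (Fin.tail X)) (2 + 1) 0
        + (cellSet (X 0)).card * tailCount (parFin 5 (Fin.tail X)) (2 + 1) 1) := by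
    rw [eY]
    simp only [tailCount_par_succ_succ _ _ (hX _), tailCount_par_succ_zero _ _ (hX _),
      tailCount_par_zero_succ _ _ (hX _), tailCount_par_zero_zero _ _ (hX _), tailCount_absent_eq]
    norm_num
    rw [← ea0, ← ea1, ← ea2, ← ea3, ← ea4, ← ea5, ← ec0, ← ec1, ← ec2, ← ec3, ← ec4, ← ec5, hc0, hc1, hc2, hc3, hc4, hc5, ← sub_nonneg]
    ring_nf
    positivity
  exact_mod_cast h

/-- **(SD) at `(4,0)` on six flow-one factors with red crossings and ARBITRARY sizes, the two least C-heavy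
factors in front**: the relay at `(3,0)` with the three count inequalities, which after the substitution `c_i = a_i (g + d_i)`,
`g = c₀/a₀`, are polynomials with non-negative coefficients -/
theorem sdomZ_six_40_front (X : Fin 6 → V2Closure.SP) (hX : ∀ i, FlowOne (X i)) (hR : ∀ i, 0 < (rSet (X i)).card)
    (hmin : FrontMinGamma X) (hmin' : FrontMinGamma (Fin.tail X)) : SDomZ (parFin 6 X) 4 0 := by
  show SDomZ (V2Closure.SP.par (X 0) (parFin 5 (Fin.tail X))) 4 0
  have hX' : ∀ i, FlowOne (Fin.tail X i) := fun i => hX i.succ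
  have ha : ∀ i, (0 : ℚ) < (rSet (X i)).card := fun i => by exact_mod_cast hR i
  obtain ⟨a1, ea1⟩ : ∃ a : ℚ, a = ((rSet (X 1)).card : ℚ) := ⟨_, rfl⟩
  obtain ⟨a2, ea2⟩ : ∃ a : ℚ, a = ((rSet (X 2)).card : ℚ) := ⟨_, rfl⟩
  obtain ⟨a3, ea3⟩ : ∃ a : ℚ, a = ((rSet (X 3)).card : ℚ) := ⟨_, rfl⟩
  obtain ⟨a4, ea4⟩ : ∃ a : ℚ, a = ((rSet (X 4)).card : ℚ) := ⟨_, rfl⟩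
  obtain ⟨a5, ea5⟩ : ∃ a : ℚ, a = ((rSet (X 5)).card : ℚ) := ⟨_, rfl⟩
  have ha1 : 0 < a1 := by rw [ea1]; exact ha 1
  have ha2 : 0 < a2 := by rw [ea2]; exact ha 2
  have ha3 : 0 < a3 := by rw [ea3]; exact ha 3
  have ha4 : 0 < a4 := by rw [ea4]; exact ha 4
  have ha5 : 0 < a5 := by rw [ea5]; exact ha 5
  obtain ⟨c1, ec1⟩ : ∃ c : ℚ, c = ((cellSet (X 1)).card : ℚ) := ⟨_, rfl⟩
  obtain ⟨c2, ec2⟩ : ∃ c : ℚ, c = ((cellSet (X 2)).card : ℚ) := ⟨_, rfl⟩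
  obtain ⟨c3, ec3⟩ : ∃ c : ℚ, c = ((cellSet (X 3)).card : ℚ) := ⟨_, rfl⟩
  obtain ⟨c4, ec4⟩ : ∃ c : ℚ, c = ((cellSet (X 4)).card : ℚ) := ⟨_, rfl⟩
  obtain ⟨c5, ec5⟩ : ∃ c : ℚ, c = ((cellSet (X 5)).card : ℚ) := ⟨_, rfl⟩
  have hc1' : 0 ≤ c1 := by rw [ec1]; exact Nat.cast_nonneg _
  have hc2' : 0 ≤ c2 := by rw [ec2]; exact Nat.cast_nonneg _
  have hc3' : 0 ≤ c3 := by rw [ec3]; exact Nat.cast_nonneg _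
  have hc4' : 0 ≤ c4 := by rw [ec4]; exact Nat.cast_nonneg _
  have hc5' : 0 ≤ c5 := by rw [ec5]; exact Nat.cast_nonneg _
  have hR' : ∀ i, 0 < (rSet (Fin.tail X i)).card := fun i => hR i.succ
  -- the sub-comb and its (SD) facts
  have hY1 : SDomZ (parFin 5 (Fin.tail X)) ((2 : ℕ) + 1) 0 := by
    norm_num; exact sdomZ_five_30_front (Fin.tail X) hX' hR' hmin'
  have hY2 : SDomZ (parFin 5 (Fin.tail X)) ((2 : ℕ) + 2) 0 := by
    norm_num
    exact sdomZ_parFin_subtop_all 5 (Fin.tail X) 4 0 hX' hR' (by norm_num) (by norm_num)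
  have hYax : SDomZ (parFin 5 (Fin.tail X)) ((2 : ℕ) + 2) (-1) := by
    have h := sdomZ_axisComb_red (axisComb_parFin 5 (Fin.tail X) (fun i => ⟨hX' i, hR' i⟩)) 3
    norm_num at h ⊢; exact h
  -- the tail counts of the sub-comb, expanded through the explicit comb
  have eY : parFin 5 (Fin.tail X)
      = V2Closure.SP.par (X 1) (V2Closure.SP.par (X 2) (V2Closure.SP.par (X 3) (V2Closure.SP.par (X 4)
          (V2Closure.SP.par (X 5) V2Closure.SP.absent)))) := rfl
  have hP : 0 < tailCount (parFin 5 (Fin.tail X)) (2 + 2) 0 := by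
    have h : (0 : ℚ) < tailCount (parFin 5 (Fin.tail X)) (2 + 2) 0 := by
      rw [eY]
      simp only [tailCount_par_succ_zero _ _ (hX _), tailCount_par_zero_zero _ _ (hX _), tailCount_absent_eq]
      norm_num
      rw [← ea1, ← ea2, ← ea3, ← ea4, ← ea5, ← ec1, ← ec2, ← ec3, ← ec4, ← ec5]
      positivity
    exact_mod_cast h
  have hS : 0 < tailCount (parFin 5 (Fin.tail X)) (2 + 1) 1 := by
    have h : (0 : ℚ) < tailCount (parFin 5 (Fin.tail X)) (2 + 1) 1 := by
      rw [eY]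
      simp only [tailCount_par_succ_succ _ _ (hX _), tailCount_par_succ_zero _ _ (hX _),
        tailCount_par_zero_succ _ _ (hX _), tailCount_par_zero_zero _ _ (hX _), tailCount_absent_eq]
      norm_num
      rw [← ea1, ← ea2, ← ea3, ← ea4, ← ea5, ← ec1, ← ec2, ← ec3, ← ec4, ← ec5]
      positivity
    exact_mod_cast h
  have key := sdomZ_par_relay_u0 (X 0) (parFin 5 (Fin.tail X)) 2 (hX 0) (hR 0) hY1 hY2 hYax hP hS
    (six40_I X hX hR hmin) (six40_II X hX hR hmin) (six40_III X hX hR hmin)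
  norm_num at key
  exact key

end Six

end Summit.Ventures.PercRepro2.Tail2D
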